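import Summits.CriticalPhenomena.CardyFormulaZ2.Theorems.CardyMagicRigidityNestingRigidityNeckCoveringB
import HarnessLib

/-!
# Crux `NestingRigidity`, line `pinch-resampling` (v4), stub S11: the covering lemma for `𝔅` with pairwise DISTINCT blobs, and interior contacts

Crux `Summit.CriticalPhenomena.CardyFormulaZ2.Theses.CardyMagicRigidity.NestingRigidity` (stmt-CriticalPhenomena-4835),
line `pinch-resampling` v4, stub S11 `stub_neckHookupCoarseT : NeckHookupCoarseT`.  Worker W6c, wave 6.

`covering_B` / `covering_B_nodes` (`…NeckCoveringB`, p162225) produce, on `𝔅 = THook ∖ THookBig`, a cardinality-minimal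
blocking family `F` of inner-layer sites of small blobs, but export neither its minimality nor its consequence that distinct
members lie in DISTINCT (hence disjoint, non-adjacent) collar blobs.  Without that clause the touching-necklace input
`TouchingNecklaceBoundT` of the S11 road map is FALSE (worker W3, wave 5: one small blob may carry all `m` members of a
window; witness in `work/stubs/w5c_TouchingNecklace_corrected.lean` of the lead's folder).  This module re-exports the
covering lemma with the clause (`covering_B_distinct`, `covering_B_distinct_nodes` — registered anchor) and records the
geometry of the two-sided contacts: a contact `a` of a side with a family blob (an endpoint of a path in `avoidSet F`
adjacent to the blob) is an INTERIOR site of `Λ_s(x)` on the sphere `|a - x|_𝕋 = s` (`NeckCoarse.contact_mem_tBall`):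
both sides of the disconnection touch every family blob from inside the ball, within `𝕋`-distance `1` of the inner layer.
-/

noncomputable section

namespace Summit.CriticalPhenomena.CardyFormulaZ2.Cruxes.NestingRigidity.PinchResampling

open MeasureTheory Set Literature.Probability.Percolation Literature.Probability.LatticeModels

section CoveringBDistinct

variable {ℓ lam s : ℕ} {x o : Site 2} {η : SiteConfig (Site 2)}

/-! ## §1 Contacts are interior -/

/-- **Contacts are interior.**  If `a` is the endpoint of an open path inside `avoidSet s x η F` (from an open site `v`)
and is adjacent in the open graph to a member `c₁` of the collar blob of some `c ∈ F`, then `a ∈ Λ_s(x)`: an open collar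
site adjacent to the blob would belong to the blob, which `avoidSet` excludes. -/
theorem NeckCoarse.contact_mem_tBall {F : Set (Site 2)} {v a c c₁ : Site 2} (hc : c ∈ F)
    (hp : PathIn (tColourGraph η true) (avoidSet s x η F) v a) (hadj : (tColourGraph η true).Adj a c₁)
    (hc₁ : c₁ ∈ blobOf (tColourGraph η true) (tBall x (2 * s) \ tBall x s) c) : a ∈ tBall x s := by
  have haS : a ∈ avoidSet s x η F := hp.right_mem
  by_contra haK
  have haA : a ∈ tBall x (2 * s) \ tBall x s := ⟨haS.1, haK⟩
  -- `a` is joined to `c₁` inside the collar, hence lies in the blob of `c`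
  have hac : a ∈ blobOf (tColourGraph η true) (tBall x (2 * s) \ tBall x s) c :=
    (PathIn.trans hc₁ (PathIn.symm (PathIn.of_adj haA (PathIn.right_mem hc₁) hadj)))
  refine haS.2 ?_
  simp only [mem_iUnion, exists_prop]
  exact ⟨c, hc, hac⟩

/-- Contacts lie on the sphere `|a - x|_𝕋 = s` (interior sites adjacent to the collar). -/
theorem NeckCoarse.triNorm_contact_eq {F : Set (Site 2)} {v a c c₁ : Site 2} (hc : c ∈ F)
    (hp : PathIn (tColourGraph η true) (avoidSet s x η F) v a) (hadj : (tColourGraph η true).Adj a c₁)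
    (hc₁ : c₁ ∈ blobOf (tColourGraph η true) (tBall x (2 * s) \ tBall x s) c) : triNorm (a - x) = s := by
  have haK := NeckCoarse.contact_mem_tBall hc hp hadj hc₁
  have hc₁A : c₁ ∈ tBall x (2 * s) \ tBall x s := PathIn.right_mem hc₁
  have hG : triGraph.Adj a c₁ := by
    have h := hadj
    rw [tColourGraph_true, siteOpenGraph_adj] at h
    exact h.1
  have h1 := triNorm_sub_le_of_adj hG x
  simp only [tBall, mem_sdiff, mem_setOf_eq, not_le] at haK hc₁A
  omega

/-! ## §2 The covering lemma with the distinct-blobs clause -/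

/-- **Covering lemma for `𝔅` with pairwise distinct blobs** (adapted from `covering_B`, `…NeckCoveringB`: the same
cardinality-minimal blocking family, with its minimality exported once more).  On `THook ∖ THookBig` (`1 ≤ lam`,
`lam + 1 ≤ s`) there is a nonempty finite family `F` of inner-layer sites of SMALL open blobs, distinct members lying in
DISTINCT blobs, every blob adjacent to both sides of a disconnection of two crossings avoiding the family, such that for EVERY nonempty
sub-family `𝒩 ⊆ F` and every inner-layer centre `w` with the sites of `𝒩` inside `Λ_Δ(w)` and those of `F ∖ 𝒩` outside
`Λ_{Γ-1}(w)`, every annulus `{r ≤ |· - w|_𝕋 ≤ R}` with `Δ + lam + 1 ≤ r ≤ R`, `R + lam ≤ Γ`, `R + 2 ≤ s` is crossed by two open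
paths lying in distinct open clusters OF THE ANNULUS. -/
theorem covering_B_distinct (hlam : 1 ≤ lam) (hls : lam + 1 ≤ s) (hH : η ∈ THook x x s s) (hnB : η ∉ THookBig lam s x) :
    ∃ F : Finset (Site 2), (∀ c ∈ F, c ∈ η ∧ c ∈ innerLayer triGraph (tBall x s) (tBall x (2 * s)) ∧
        ¬ ∃ w ∈ blobOf (tColourGraph η true) (tBall x (2 * s) \ tBall x s) c,
          ∃ w' ∈ blobOf (tColourGraph η true) (tBall x (2 * s) \ tBall x s) c, (lam : ℤ) ≤ triNorm (w - w')) ∧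
      F.Nonempty ∧
      (∀ c ∈ F, ∀ c' ∈ F, c ≠ c' → c' ∉ blobOf (tColourGraph η true) (tBall x (2 * s) \ tBall x s) c) ∧
      (∃ v v' : Site 2, IsCrossing triGraph (tColourGraph η true) (tBall x s) (tBall x (2 * s)) v ∧
        IsCrossing triGraph (tColourGraph η true) (tBall x s) (tBall x (2 * s)) v' ∧
        ¬ PathIn (tColourGraph η true) (avoidSet s x η ↑F) v v' ∧
        ∀ c ∈ F, ∃ a₁ c₁ a₂ c₂, PathIn (tColourGraph η true) (avoidSet s x η ↑F) v a₁ ∧ (tColourGraph η true).Adj a₁ c₁ ∧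
          c₁ ∈ blobOf (tColourGraph η true) (tBall x (2 * s) \ tBall x s) c ∧
          PathIn (tColourGraph η true) (avoidSet s x η ↑F) v' a₂ ∧ (tColourGraph η true).Adj a₂ c₂ ∧
          c₂ ∈ blobOf (tColourGraph η true) (tBall x (2 * s) \ tBall x s) c) ∧
      ∀ 𝒩 ⊆ F, 𝒩.Nonempty → ∀ (w : Site 2) (Δ r R Γ : ℕ),
        w ∈ innerLayer triGraph (tBall x s) (tBall x (2 * s)) →
        (∀ c ∈ 𝒩, triNorm (c - w) ≤ Δ) → (∀ c ∈ F, c ∉ 𝒩 → (Γ : ℤ) ≤ triNorm (c - w)) →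
        Δ + lam + 1 ≤ r → r ≤ R → R + lam ≤ Γ → R + 2 ≤ s →
        ∃ p₁ q₁ p₂ q₂, triNorm (p₁ - w) = r ∧ triNorm (q₁ - w) = R ∧ triNorm (p₂ - w) = r ∧ triNorm (q₂ - w) = R ∧
          PathIn (tColourGraph η true) (tAnn w r R) p₁ q₁ ∧ PathIn (tColourGraph η true) (tAnn w r R) p₂ q₂ ∧
          ¬ PathIn (tColourGraph η true) (tAnn w r R) p₁ p₂ := by
  classical
  set K := tBall x s with hK
  set O := tBall x (2 * s) with hO
  set H := tColourGraph η true with hH'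
  -- two crossings, hooked up but not through the big blobs
  have hvw : ∃ v v', IsCrossing triGraph H K O v ∧ IsCrossing triGraph H K O v' ∧
      ¬ PathIn triGraph (bigRoute lam s x η ∩ O) v v' := by
    by_contra hcon
    push Not at hcon
    exact hnB fun v v' hv hv' ↦ hcon v v' hv hv'
  obtain ⟨v, v', hv, hv', hnvv'⟩ := hvw
  have hreal : PathIn H O v v' := hH v v' hv hv'
  -- crossings are open with big blobs
  have hbigc : ∀ {v : Site 2}, IsCrossing triGraph H K O v →
      (∃ w₁ ∈ blobOf H (O \ K) v, ∃ w₂ ∈ blobOf H (O \ K) v, (lam : ℤ) ≤ triNorm (w₁ - w₂)) ∧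
      (∃ w₁ ∈ blobOf H (O \ K) v, w₁ ∈ outerLayer triGraph K O) ∧ v ∈ η := by
    rintro v ⟨hvL, w₁, hw₁o, hp⟩
    have h1 := triNorm_le_of_mem_innerLayer hvL
    have h2 := le_triNorm_of_mem_outerLayer hw₁o
    have h3 := triNorm_sub_le_triNorm_sub_add w₁ v x
    have hne : v ≠ w₁ := by
      rintro rfl
      push_cast at h2
      omega
    refine ⟨⟨w₁, hp, v, NeckCoarse.self_mem_blobOf hvL.1, ?_⟩, ⟨w₁, hp, hw₁o⟩, ?_⟩
    · push_cast at h2; omega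
    · rw [hH', tColourGraph_true] at hp
      exact NeckCoarse.mem_of_pathIn_ne hp hne
  -- the universe of small inner-touching open blob sites, and the avoidance property
  let Sm : Set (Site 2) := {c | c ∈ η ∧ c ∈ innerLayer triGraph K O ∧
    ¬ ∃ w ∈ blobOf H (O \ K) c, ∃ w' ∈ blobOf H (O \ K) c, (lam : ℤ) ≤ triNorm (w - w')}
  have hfin : Sm.Finite := (tBall_finite x (2 * s)).subset fun c hc ↦ hc.2.1.1.1
  set U : Finset (Site 2) := hfin.toFinset with hU
  have hUS : (↑U : Set (Site 2)) = Sm := by simp [hU]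
  let P : Finset (Site 2) → Prop := fun F ↦ ¬ PathIn H (avoidSet s x η ↑F) v v'
  have hPU : P U := by
    intro hp
    rw [hUS] at hp
    exact hnvv' (pathIn_bigRoute_of_avoid hv (hbigc hv).1 (hbigc hv).2.2 hp).1
  set 𝒞 := U.powerset.filter P with h𝒞
  have hU𝒞 : U ∈ 𝒞 := Finset.mem_filter.2 ⟨Finset.mem_powerset.2 subset_rfl, hPU⟩
  obtain ⟨F, hF𝒞, hFmin⟩ := Finset.exists_min_image 𝒞 Finset.card ⟨U, hU𝒞⟩
  obtain ⟨hFU, hFP⟩ := Finset.mem_filter.1 hF𝒞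
  have hFU' : ∀ c ∈ F, c ∈ Sm := fun c hc ↦ by
    have := Finset.mem_powerset.1 hFU hc
    simpa [hU] using this
  have hmin : ∀ 𝒩 ⊆ F, 𝒩.Nonempty → PathIn H (avoidSet s x η ↑(F \ 𝒩)) v v' := by
    intro 𝒩 h𝒩 hne
    by_contra hch
    have hmem : F \ 𝒩 ∈ 𝒞 :=
      Finset.mem_filter.2 ⟨Finset.mem_powerset.2 (Finset.sdiff_subset.trans (Finset.mem_powerset.1 hFU)), hch⟩
    have h1 := hFmin _ hmem
    have h2 : (F \ 𝒩).card < F.card := by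
      obtain ⟨e, he⟩ := hne
      exact Finset.card_lt_card (Finset.sdiff_ssubset h𝒩 ⟨e, he⟩)
    omega
  -- big blobs avoid the family; in particular the crossing blobs do
  have hbig_avoid : ∀ {u z : Site 2}, (∃ w₁ ∈ blobOf H (O \ K) u, ∃ w₂ ∈ blobOf H (O \ K) u, (lam : ℤ) ≤ triNorm (w₁ - w₂)) →
      z ∈ blobOf H (O \ K) u → z ∈ avoidSet s x η ↑F := by
    intro u z hbig hz
    refine ⟨(PathIn.right_mem hz).1, fun hz' ↦ ?_⟩
    simp only [mem_iUnion, Finset.mem_coe, exists_prop] at hz'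
    obtain ⟨c, hc, hzc⟩ := hz'
    have hcu : blobOf H (O \ K) c = blobOf H (O \ K) u :=
      (NeckCoarse.blobOf_eq_of_mem hzc).symm.trans (NeckCoarse.blobOf_eq_of_mem hz)
    refine (hFU' c hc).2.2 ?_
    rw [hcu]; exact hbig
  have memU : ∀ (S : Set (Site 2)) (z : Site 2),
      z ∈ (⋃ c ∈ S, blobOf H (O \ K) c) ↔ ∃ c ∈ S, z ∈ blobOf H (O \ K) c := fun S z ↦ by
    simp only [mem_iUnion, exists_prop]
  -- `avoidSet F` is `avoidSet (F ∖ 𝒩)` minus the `𝒩`-blobs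
  have hsplit : ∀ (𝒩 : Finset (Site 2)),
      (⋃ c ∈ (↑𝒩 : Set (Site 2)), blobOf H (O \ K) c)ᶜ ∩ avoidSet s x η ↑(F \ 𝒩) ⊆ avoidSet s x η ↑F := by
    rintro 𝒩 z ⟨hzN, hzO, hzFN⟩
    refine ⟨hzO, fun hzF ↦ ?_⟩
    obtain ⟨c, hc, hzc⟩ := (memU _ z).1 hzF
    by_cases hcN : c ∈ 𝒩
    · exact hzN ((memU _ z).2 ⟨c, Finset.mem_coe.2 hcN, hzc⟩)
    · exact hzFN ((memU _ z).2 ⟨c, Finset.mem_coe.2 (Finset.mem_sdiff.2 ⟨Finset.mem_coe.1 hc, hcN⟩), hzc⟩)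
  have hside : ∀ (𝒩 : Finset (Site 2)), 𝒩 ⊆ F → ∀ {c₀ c₁ : Site 2}, IsCrossing triGraph H K O c₀ →
      PathIn H (avoidSet s x η ↑(F \ 𝒩)) c₀ c₁ → ¬ PathIn H (avoidSet s x η ↑F) c₀ c₁ →
      ∃ a cc, PathIn H (avoidSet s x η ↑F) c₀ a ∧ H.Adj a cc ∧
        ∃ c ∈ 𝒩, cc ∈ blobOf H (O \ K) c := by
    intro 𝒩 h𝒩 c₀ c₁ hc₀ hp hn
    have hc₀R : c₀ ∈ (⋃ c ∈ (↑𝒩 : Set (Site 2)), blobOf H (O \ K) c)ᶜ := by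
      intro h0
      obtain ⟨c, hc, h⟩ := (memU _ c₀).1 h0
      exact (hbig_avoid (hbigc hc₀).1 (NeckCoarse.self_mem_blobOf hc₀.1.1)).2
        ((memU _ c₀).2 ⟨c, Finset.mem_coe.2 (h𝒩 (Finset.mem_coe.1 hc)), h⟩)
    rcases hp.exit_or (R := (⋃ c ∈ (↑𝒩 : Set (Site 2)), blobOf H (O \ K) c)ᶜ) hc₀R with
      hstay | ⟨a, cc, -, hccR, -, hadj, hpref⟩
    · exact (hn (hstay.mono (hsplit 𝒩))).elim
    · refine ⟨a, cc, hpref.mono (hsplit 𝒩), hadj, ?_⟩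
      simp only [mem_compl_iff, not_not] at hccR
      obtain ⟨c, hc, hcc⟩ := (memU _ cc).1 hccR
      exact ⟨c, Finset.mem_coe.1 hc, hcc⟩
  refine ⟨F, fun c hc ↦ hFU' c hc, ?_, ?_, ⟨v, v', hv, hv', hFP, fun c hc ↦ ?_⟩, ?_⟩
  · by_contra hemp
    rw [Finset.not_nonempty_iff_eq_empty] at hemp
    refine hFP (hreal.mono fun z hz ↦ ⟨hz, ?_⟩)
    simp [hemp]
  · -- distinct members lie in distinct blobs: else removing one of them changes nothing (minimality)
    intro c hc c' hc' hne hmem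
    have hsub : ({c'} : Finset (Site 2)) ⊆ F := Finset.singleton_subset_iff.2 hc'
    have hρ := hmin {c'} hsub ⟨c', Finset.mem_singleton_self c'⟩
    refine hFP (hρ.mono fun z hz ↦ ⟨hz.1, fun hz' ↦ hz.2 ?_⟩)
    obtain ⟨k, hk, hzk⟩ := (memU _ z).1 hz'
    by_cases hkc' : k = c'
    · subst hkc'
      have hkb : blobOf H (O \ K) k = blobOf H (O \ K) c := NeckCoarse.blobOf_eq_of_mem hmem
      refine (memU _ z).2 ⟨c, Finset.mem_coe.2 (Finset.mem_sdiff.2 ⟨hc, fun h ↦ hne ?_⟩), hkb ▸ hzk⟩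
      exact Finset.mem_singleton.1 h
    · exact (memU _ z).2 ⟨k, Finset.mem_coe.2 (Finset.mem_sdiff.2 ⟨Finset.mem_coe.1 hk, fun h ↦ hkc'
        (Finset.mem_singleton.1 h)⟩), hzk⟩
  · -- every family blob is adjacent to both sides
    have hsub : ({c} : Finset (Site 2)) ⊆ F := Finset.singleton_subset_iff.2 hc
    have hρ := hmin {c} hsub ⟨c, Finset.mem_singleton_self c⟩
    obtain ⟨a₁, c₁, hpa₁, hadj₁, k₁, hk₁, hc₁⟩ := hside {c} hsub hv hρ hFP
    obtain ⟨a₂, c₂, hpa₂, hadj₂, k₂, hk₂, hc₂⟩ := hside {c} hsub hv' hρ.symm fun h ↦ hFP h.symm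
    rw [Finset.mem_singleton] at hk₁ hk₂
    subst hk₁; subst hk₂
    exact ⟨a₁, c₁, a₂, c₂, hpa₁, hadj₁, hc₁, hpa₂, hadj₂, hc₂⟩
  intro 𝒩 h𝒩 hne w Δ r R Γ hw hΔ hΓ hr hrR hRΓ hRs
  -- the annulus avoids the family
  have hAnn : tAnn w r R ⊆ avoidSet s x η ↑F := by
    intro z hz
    refine ⟨tAnn_subset_tBall hw (by omega) hz, fun hz' ↦ ?_⟩
    simp only [mem_iUnion, Finset.mem_coe, exists_prop] at hz'
    obtain ⟨c, hc, hzc⟩ := hz'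
    have hd := triNorm_sub_lt_of_small (hFU' c hc).2.2 hzc (NeckCoarse.self_mem_blobOf (hFU' c hc).2.1.1)
    have h1 := triNorm_sub_le_triNorm_sub_add z c w
    have h2 := triNorm_sub_le_triNorm_sub_add c z w
    have h3 : triNorm (c - z) = triNorm (z - c) := by rw [← triNorm_neg, neg_sub]
    obtain ⟨hzr, hzR⟩ := hz
    by_cases hcN : c ∈ 𝒩
    · have := hΔ c hcN; omega
    · have := hΓ c hc hcN; omega
  -- a connection avoiding `F ∖ 𝒩` exists and must enter an `𝒩`-blob: first entry from each side
  have hρ := hmin 𝒩 h𝒩 hne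
  obtain ⟨a₁, c₁, hpa₁, hadj₁, k₁, hk₁, hc₁⟩ := hside 𝒩 h𝒩 hv hρ hFP
  obtain ⟨a₂, c₂, hpa₂, hadj₂, k₂, hk₂, hc₂⟩ := hside 𝒩 h𝒩 hv' hρ.symm fun h ↦ hFP h.symm
  -- the two sides are not connected inside the avoiding set
  have hn12 : ¬ PathIn H (avoidSet s x η ↑F) a₁ a₂ := fun h ↦ hFP ((hpa₁.trans h).trans hpa₂.symm)
  have hHG : ∀ {a b : Site 2}, H.Adj a b → triGraph.Adj a b := fun hab ↦ by
    rw [hH', tColourGraph_true, siteOpenGraph_adj] at hab; exact hab.1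
  -- near
  have hnear : ∀ {a cc k : Site 2}, H.Adj a cc → k ∈ 𝒩 → cc ∈ blobOf H (O \ K) k → triNorm (a - w) < r := by
    intro a cc k hadj hk hcc
    have h1 : triNorm (a - cc) ≤ 1 := by
      have := triNorm_sub_le_of_adj (hHG hadj).symm cc
      simp at this
      have h0 : triNorm (cc - cc) = 0 := by simp
      omega
    have h2 := triNorm_sub_lt_of_small (hFU' k (h𝒩 hk)).2.2 hcc (NeckCoarse.self_mem_blobOf (hFU' k (h𝒩 hk)).2.1.1)
    have h3 := hΔ k hk
    have h4 := triNorm_sub_le_triNorm_sub_add a cc w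
    have h5 := triNorm_sub_le_triNorm_sub_add cc k w
    omega
  -- far: through the crossing blob to the outer layer
  have hfar : ∀ {c₀ a : Site 2}, IsCrossing triGraph H K O c₀ → PathIn H (avoidSet s x η ↑F) c₀ a →
      ∃ q, PathIn H (avoidSet s x η ↑F) a q ∧ (R : ℤ) ≤ triNorm (q - w) := by
    intro c₀ a hc₀ hp
    obtain ⟨hbig, ⟨q, hq, hqo⟩, -⟩ := hbigc hc₀
    -- restrict the crossing path to `avoidSet`, which contains every point reachable along the way
    have hrestr : ∀ {A B : Set (Site 2)} {u v : Site 2}, PathIn H A u v → (∀ z, PathIn H A u z → z ∈ B) →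
        PathIn H B u v := by
      intro A B u v h hB
      obtain ⟨hu, p⟩ := h
      have hu' : u ∈ B := hB u (PathIn.refl hu)
      induction p with
      | refl => exact PathIn.refl hu'
      | @tail y z hyp hyz ih => exact (ih).tail hyz.1 (hB z ⟨hu, hyp.tail hyz⟩)
    refine ⟨q, hp.symm.trans (hrestr hq fun z hz ↦ hbig_avoid hbig hz), ?_⟩
    · have h1 := le_triNorm_of_mem_outerLayer hqo
      have h2 := triNorm_le_of_mem_innerLayer hw
      have h3 := triNorm_sub_le_triNorm_sub_add q w x
      push_cast at h1; omega
  obtain ⟨q₁', ha₁q, hq₁R⟩ := hfar hv hpa₁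
  obtain ⟨q₂', ha₂q, hq₂R⟩ := hfar hv' hpa₂
  obtain ⟨p₁, q₁, hp₁, hq₁, hcross₁, ha₁p₁⟩ := exists_crossing_of_pathIn hrR (hnear hadj₁ hk₁ hc₁) hq₁R ha₁q
  obtain ⟨p₂, q₂, hp₂, hq₂, hcross₂, ha₂p₂⟩ := exists_crossing_of_pathIn hrR (hnear hadj₂ hk₂ hc₂) hq₂R ha₂q
  refine ⟨p₁, q₁, p₂, q₂, hp₁, hq₁, hp₂, hq₂, hcross₁.mono inter_subset_right, hcross₂.mono inter_subset_right,
    fun h12 ↦ hn12 ?_⟩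
  exact ha₁p₁.trans ((h12.mono hAnn).trans ha₂p₂.symm)


/-- **Covering lemma for `𝔅` with pairwise distinct blobs, closed form (registered helper, anchor of this module on the crux
item; all parameters explicit)**: see `covering_B_distinct`. -/
theorem covering_B_distinct_nodes : ∀ (lam s : ℕ) (x : Site 2) (η : SiteConfig (Site 2)), 1 ≤ lam → lam + 1 ≤ s → η ∈ THook x x s s → η ∉ THookBig lam s x → ∃ F : Finset (Site 2), (∀ c ∈ F, c ∈ η ∧ c ∈ innerLayer triGraph (tBall x s) (tBall x (2 * s)) ∧ ¬ ∃ w ∈ blobOf (tColourGraph η true) (tBall x (2 * s) \ tBall x s) c, ∃ w' ∈ blobOf (tColourGraph η true) (tBall x (2 * s) \ tBall x s) c, (lam : ℤ) ≤ triNorm (w - w')) ∧ F.Nonempty ∧ (∀ c ∈ F, ∀ c' ∈ F, c ≠ c' → c' ∉ blobOf (tColourGraph η true) (tBall x (2 * s) \ tBall x s) c) ∧ (∃ v v' : Site 2, IsCrossing triGraph (tColourGraph η true) (tBall x s) (tBall x (2 * s)) v ∧ IsCrossing triGraph (tColourGraph η true) (tBall x s) (tBall x (2 * s)) v' ∧ ¬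 PathIn (tColourGraph η true) (avoidSet s x η ↑F) v v' ∧ ∀ c ∈ F, ∃ a₁ c₁ a₂ c₂ : Site 2, PathIn (tColourGraph η true) (avoidSet s x η ↑F) v a₁ ∧ (tColourGraph η true).Adj a₁ c₁ ∧ c₁ ∈ blobOf (tColourGraph η true) (tBall x (2 * s) \ tBall x s) c ∧ PathIn (tColourGraph η true) (avoidSet s x η ↑F) v' a₂ ∧ (tColourGraph η true).Adj a₂ c₂ ∧ c₂ ∈ blobOf (tColourGraph η true) (tBall x (2 * s) \ tBall x s) c) ∧ ∀ 𝒩 ⊆ F, 𝒩.Nonempty → ∀ (w : Site 2) (Δ r R Γ : ℕ), w ∈ innerLayer triGraph (tBall x s) (tBall x (2 * s)) → (∀ c ∈ 𝒩, triNorm (c - w) ≤ Δ) → (∀ c ∈ F, c ∉ 𝒩 → (Γ : ℤ) ≤ triNorm (c - w)) → Δ + lam + 1 ≤ r → r ≤ R → R + lam ≤ Γ → R + 2 ≤ s → ∃ p₁ q₁ p₂ q₂ : Site 2, triNorm (p₁ - w) = r ∧ triNorm (q₁ - w) = R ∧ triNorm (p₂ - w) = r ∧ triNorm (q₂ - w)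 = R ∧ PathIn (tColourGraph η true) (tAnn w r R) p₁ q₁ ∧ PathIn (tColourGraph η true) (tAnn w r R) p₂ q₂ ∧ ¬ PathIn (tColourGraph η true) (tAnn w r R) p₁ p₂ :=
  fun _ _ _ _ hlam hls hH hnB ↦ covering_B_distinct hlam hls hH hnB

end CoveringBDistinct

end Summit.CriticalPhenomena.CardyFormulaZ2.Cruxes.NestingRigidity.PinchResampling

end
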